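import Summits.Ventures.GridStability.Models.SMIBPoleSlipK13

/-!
# GridStability/Models/SMIBPoleSlipK13Range — the pole-slip bound of «SMIB-K13post-D10» in THRESHOLD sense: every clearing instant `t_cl ∈ [0.135, 0.24] s` loses synchronism (kernel-only)

Cell `gridfusion` (LADDER-GRIDFUSION G1.SMIB / sub-rung G1-cct; line «G1cct-SMIB-UPPER-K», lead
R-CCT-UPPER-SMIB; lit-1 06:19:49Z: «THRESHOLD sense on the unstable side needs m∘x_F non-decreasing»),
seat gridfusion-model-1.  THREE COLUMNS: a-priori kernel theorem about the typed MODEL M′_SMIB (MODELLED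
as in `SMIBPoleSlipK13`: classical SMIB `K13postD10`, zero-power fault `K13fault (10/377)` with the
`K_D = 10` damping in force, δ₀ ∈ [0.7290, 0.7291], ω₀ = 0 [cite: Kundur1994, Example 13.1 and
Example 12.2 (iii)]).  No solver, no enclosure engine.

UPGRADE OF `K13postD10_poleSlip_of_clearing_0135` (clearing AT 0.135 s) TO AN INTERVAL OF CLEARING TIMES
without any monotonicity theorem for the excess energy: along the fault-on arc the speed is
non-decreasing (`ω̇_F = a − kω_F ≥ 0` since `kω_F ≤ k·a·t ≤ a` while `k t ≤ 1`; here `kT ≤ (10/7)·0.24 < 1`) and so is the angle, hence the cleared state at ANY `T ∈ [0.135, 0.24]` satisfies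
`ω_c ≥ ω_F(0.135) ≥ 5.951`, `δ_c ≥ δ_F(0.135) ≥ 1.1423` (the certified enclosures of the point file) and
`δ_c ≤ δ₀ + aT²/2 ≤ 2.1251 < δ^u`; and the EXCESS of lit-1's criterion,
`Ψ = ½Mω_c² + V_PE(δ_c) − D ω_c (δ^u − δ_c)`, is MONOTONE in the cleared state on that range
(`V_PE` and `δ ↦ −Dω_c(δ^u − δ)` increase with `δ_c ∈ [δˢ, δ^u]`; `ω ↦ ½Mω² − Dωr` increases for
`ω ≥ 5.951 > (D/M)·r`, factorisation `(ω − w₀)(½M(ω + w₀) − Dr) ≥ 0`), so `Ψ ≥ Ψ(5.951, 1.1423) ≥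
0.17398 > V_cr + 1/1000`.  RESULT `K13postD10_poleSlip_of_clearing_ge_0135`: **for every `T ∈ [27/200, 6/25]`,
every fault-on motion `Y` on `[0, T]` from the declared window at rest, and EVERY global post-fault solution
`X` of `K13postD10` with `X 0 = Y T`: `∃ t ≥ 0, δ(t) − δˢ > π`.**  (Beyond `0.24 s` the cleared angle may
already exceed `δ^u`; that regime is lit-1's `exceeds_pi_add_of_beyond_uep`, not needed for the tier.)
Two-sided kernel reading of the SMIB tier, both sides now THRESHOLDS: `t_cl ≤ 0.112 s` resynchronises
(#19) — `t_cl ∈ [0.135, 0.24] s` pole-slips.  No sentence here is about a machine or a grid.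
[cite: SauerPai1998, §9.6.2 (text after (9.36)) and §9.6.3 (9.48); Kundur1994, §13.1.3]
-/

noncomputable section

open Real Set Filter Topology

namespace Summit.Ventures.GridStability.Models.SMIBOrbit

/-- Along the zero-power fault-on arc `ω̇ = a − kω` from rest (`a ≥ 0`, `k ≥ 0`), the speed is
NON-DECREASING on `[0, T]` as long as `k·T ≤ 1` (then `kω ≤ k·a·t ≤ a`, so `ω̇ ≥ 0`).
[cite: Kundur1994, Example 13.1] -/
theorem faultOn_speed_monotoneOn {a k T : ℝ} (ha : 0 ≤ a) (hk : 0 ≤ k) (hkT : k * T ≤ 1)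
    {δF ωF : ℝ → ℝ} (hδ : ∀ t ∈ Icc 0 T, HasDerivWithinAt δF (ωF t) (Icc 0 T) t)
    (hω : ∀ t ∈ Icc 0 T, HasDerivWithinAt ωF (a - k * ωF t) (Icc 0 T) t) (hω0 : ωF 0 = 0) :
    MonotoneOn ωF (Icc 0 T) := by
  refine monotoneOn_of_hasDerivWithinAt_nonneg (convex_Icc 0 T)
    (fun s hs => (hω s hs).continuousWithinAt)
    (fun s hs => (hω s (interior_subset hs)).mono interior_subset) fun s hs => ?_
  have hs' : s ∈ Icc 0 T := interior_subset hs
  obtain ⟨⟨-, h3⟩, -, -⟩ := faultOn_bounds4 ha hk hδ hω hω0 hs'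
  have hks : k * s ≤ 1 := le_trans (mul_le_mul_of_nonneg_left hs'.2 hk) hkT
  have hks0 : 0 ≤ k * s := mul_nonneg hk hs'.1
  -- ω ≤ a s (the cubic partial sum is below a s when k s ≤ 3)
  have hω_le : ωF s ≤ a * s := by
    have h2 : 0 ≤ a * k * s ^ 2 := by positivity
    have : a * k ^ 2 * s ^ 3 / 6 ≤ a * k * s ^ 2 / 2 := by nlinarith [hks, h2]
    linarith
  -- k ω ≤ k a s ≤ a
  have : k * ωF s ≤ a := by
    calc k * ωF s ≤ k * (a * s) := mul_le_mul_of_nonneg_left hω_le hk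
      _ = a * (k * s) := by ring
      _ ≤ a * 1 := mul_le_mul_of_nonneg_left hks ha
      _ = a := mul_one a
  linarith

end Summit.Ventures.GridStability.Models.SMIBOrbit

namespace Summit.Ventures.GridStability.Models.SMIB

/-- **POLE SLIP FOR EVERY CLEARING INSTANT `t_cl ∈ [0.135, 0.24] s` (kernel-only; the unstable side of the
SMIB clearing-time tier in THRESHOLD sense).**  MODELLED: classical SMIB M′ = «SMIB-K13post-D10»
(`K13postD10`; zero-power fault-on record `K13fault (10/377)`, δ₀ ∈ [0.7290, 0.7291], ω₀ = 0).
STATEMENT: for every `T` with `27/200 ≤ T ≤ 6/25`, every fault-on motion `Y` on `[0, T]`, and EVERY global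
post-fault solution `X` of `K13postD10` (on every `[0, S]`) with `X 0 = Y T`: `∃ t ≥ 0, π < δ(t) − δˢ`.
Proof: monotone fault-on speed/angle put the cleared state in `{ω_c ≥ 5.951, 1.1423 ≤ δ_c ≤ 2.1251}`,
on which the excess of `SMIB.poleSlip_of_excessEnergy` (lit-1 p504520) is bounded below by its value at
`(5.951, 1.1423)`, certified positive with `m = 1/1000` as in the point file.
[cite: SauerPai1998, §9.6.2 (text after (9.36)); Kundur1994, §13.1.3 and Example 13.1] -/
theorem K13postD10_poleSlip_of_clearing_ge_0135 {T : ℝ} (hT1 : 27 / 200 ≤ T) (hT2 : T ≤ 6 / 25)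
    {Y : ℝ → ℝ × ℝ} (hY : (K13fault (10 / 377)).IsSolutionOn Y (Icc 0 T))
    (hδ0 : (Y 0).1 ∈ Icc (7290 / 10000 : ℝ) (7291 / 10000)) (hω0 : (Y 0).2 = 0)
    {X : ℝ → ℝ × ℝ} (hX0 : X 0 = Y T) (hX : ∀ S : ℝ, K13postD10.IsSolutionOn X (Icc 0 S)) :
    ∃ t : ℝ, 0 ≤ t ∧ π < (X t).1 - deltaK13 := by
  obtain ⟨hδ, hω⟩ := K13fault_scalar hY
  have hω' : ∀ t ∈ Icc (0 : ℝ) T, HasDerivWithinAt (fun s => (Y s).2)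
      ((4303847457 / 88791425 : ℝ) - (10 / 7 : ℝ) * (fun s => (Y s).2) t) (Icc 0 T) t := by
    intro t ht
    refine (hω t ht).congr_deriv ?_
    ring
  have h0135 : (27 / 200 : ℝ) ∈ Icc (0 : ℝ) T := ⟨by norm_num, hT1⟩
  have hTT : T ∈ Icc (0 : ℝ) T := ⟨by linarith, le_rfl⟩
  -- enclosures at 0.135 (point file) and monotonicity up to T
  obtain ⟨⟨hωlo, -⟩, hδlo, -⟩ := SMIBOrbit.faultOn_bounds4 (by norm_num) (by norm_num) hδ hω' hω0 h0135
  obtain ⟨-, -, hδhiT⟩ := SMIBOrbit.faultOn_bounds4 (by norm_num) (by norm_num) hδ hω' hω0 hTT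
  have hωmono := SMIBOrbit.faultOn_speed_monotoneOn (a := 4303847457 / 88791425) (k := 10 / 7)
    (by norm_num) (by norm_num) (by linarith [hT2]) hδ hω' hω0
  have hδmono : MonotoneOn (fun s => (Y s).1) (Icc 0 T) := by
    -- δ̇ = ω ≥ 0 (ω non-decreasing from ω(0) = 0)
    refine monotoneOn_of_hasDerivWithinAt_nonneg (convex_Icc 0 T)
      (fun s hs => (hδ s hs).continuousWithinAt)
      (fun s hs => (hδ s (interior_subset hs)).mono interior_subset) fun s hs => ?_
    have h := hωmono ⟨le_rfl, by linarith⟩ (interior_subset hs) (interior_subset hs).1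
    dsimp only at h ⊢
    rw [hω0] at h
    exact h
  have hδ01 := hδ0.1
  have hδ02 := hδ0.2
  have hωc_lo : (5951 / 1000 : ℝ) ≤ (Y T).2 := by
    have h1 : (Y (27 / 200)).2 ≤ (Y T).2 := hωmono h0135 hTT hT1
    exact le_trans (le_trans (by norm_num) hωlo) h1
  have hδc_lo : (11423 / 10000 : ℝ) ≤ (Y T).1 := by
    have h1 : (Y (27 / 200)).1 ≤ (Y T).1 := hδmono h0135 hTT hT1
    refine le_trans (le_trans ?_ hδlo) h1
    norm_num at hδ01 ⊢; linarith
  have hδc_hi : (Y T).1 ≤ 21251 / 10000 := by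
    refine le_trans hδhiT ?_
    have hT2sq : T ^ 2 ≤ (6 / 25 : ℝ) ^ 2 := pow_le_pow_left₀ (by linarith) hT2 2
    norm_num at hδ02 hT2sq ⊢; nlinarith
  -- the post-fault record and its facts
  set p := K13postD10.toLit with hp
  have hpv : p = ⟨7 / 377, 10 / 377, 79912287 / 88791425, 689 / 625⟩ := K13postD10_toLit
  have hM : 0 < p.M := by rw [hpv]; norm_num
  have hD : 0 ≤ p.D := by rw [hpv]; norm_num
  have hPmax : 0 < p.Pmax := by rw [hpv]; norm_num
  have heq : p.IsEquilibriumAngle deltaK13 :=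
    (toLit_isEquilibriumAngle_iff K13postD10_γ deltaK13).2 K13postD10_isEquilibrium
  have hXlit : ∀ S : ℝ, ∀ t ∈ Icc 0 S, HasDerivWithinAt X (p.vectorField (X t)) (Icc 0 S) t :=
    fun S => (isSolutionOn_iff_toLit K13postD10_γ X _).1 (hX S)
  have hδs_lo := deltaK13_gt'
  have hδs_hi := deltaK13_lt
  have hπlo := Real.pi_gt_d6
  have hπhi := Real.pi_lt_d6
  rw [← hX0] at hωc_lo hδc_lo hδc_hi
  have hδc : deltaK13 ≤ (X 0).1 := by norm_num at hδs_hi hδc_lo ⊢; linarith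
  have hδcu : (X 0).1 ≤ π - deltaK13 := by norm_num at hδs_hi hδc_hi hπlo ⊢; linarith
  have hωc : 0 < (X 0).2 := by norm_num at hωc_lo ⊢; linarith
  -- the excess, bounded below by its value at (5.951, 1.1423)
  have hVcr := K13postD10_criticalEnergy_lt
  rw [← hp] at hVcr
  have hmono := SMIBOrbit.potentialEnergy_strictMonoOn hPmax heq deltaK13_pos.le
    deltaK13_lt_pi_div_two.le
  have hPE1 : p.potentialEnergy deltaK13 (11423 / 10000) ≤ p.potentialEnergy deltaK13 (X 0).1 := by
    refine hmono.monotoneOn ⟨?_, ?_⟩ ⟨hδc, hδcu⟩ hδc_lo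
    · norm_num at hδs_hi ⊢; linarith
    · norm_num at hδs_hi hπlo ⊢; linarith
  have hcos : cos (11423 / 10000 : ℝ) ≤ AngleEnclosure.cosUpper4 (11423 / 10000) :=
    AngleEnclosure.cos_le_cosUpper4 (by norm_num) (by linarith [pi_gt_three])
  have hPE2 : (10027 / 1000000 : ℝ) ≤ p.potentialEnergy deltaK13 (11423 / 10000) := by
    rw [hpv]
    unfold Literature.MathematicalPhysics.PowerSystems.SMIB.potentialEnergy
    rw [cos_deltaK13]
    simp only [cStar]
    push_cast
    norm_num [AngleEnclosure.dbl, AngleEnclosure.cosUpper4] at hcos hδs_lo ⊢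
    nlinarith
  -- (ω, δ) ↦ ½Mω² − Dω(π − δˢ − δ): monotone in δ (ω ≥ 0) and in ω (ω ≥ 5.951 ≥ (D/M)(π − δˢ − δ))
  have hr0 : 0 ≤ π - deltaK13 - (X 0).1 := by linarith
  have hr1 : π - deltaK13 - (X 0).1 ≤ 3141593 / 1000000 - 9551 / 10000 - 11423 / 10000 := by
    norm_num at hπhi hδs_lo hδc_lo ⊢; linarith
  have hkin : (1 : ℝ) / 2 * (7 / 377) * (5951 / 1000) ^ 2 -
      (10 / 377) * (5951 / 1000) * (3141593 / 1000000 - 9551 / 10000 - 11423 / 10000) ≤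
      1 / 2 * p.M * (X 0).2 ^ 2 - p.D * (X 0).2 * (π - deltaK13 - (X 0).1) := by
    rw [hpv]
    dsimp only
    -- step 1 (in δ): −Dω r ≥ −Dω r_hi;  step 2 (in ω): (ω − w₀)(½M(ω + w₀) − D r_hi) ≥ 0
    have hω0' : (0 : ℝ) ≤ (X 0).2 := hωc.le
    have s1 : (10 / 377 : ℝ) * (X 0).2 * (π - deltaK13 - (X 0).1) ≤
        (10 / 377 : ℝ) * (X 0).2 * (3141593 / 1000000 - 9551 / 10000 - 11423 / 10000) :=
      mul_le_mul_of_nonneg_left hr1 (by positivity)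
    have s2 : 0 ≤ ((X 0).2 - 5951 / 1000) *
        ((1 : ℝ) / 2 * (7 / 377) * ((X 0).2 + 5951 / 1000) -
          (10 / 377) * (3141593 / 1000000 - 9551 / 10000 - 11423 / 10000)) := by
      apply mul_nonneg (by linarith)
      norm_num at hωc_lo ⊢; nlinarith
    nlinarith [s1, s2]
  have hexcess : p.criticalEnergy deltaK13 + 1 / 1000 + p.D * (X 0).2 * (π - deltaK13 - (X 0).1) ≤
      p.energy deltaK13 (X 0) := by
    have hE : p.energy deltaK13 (X 0) = 1 / 2 * p.M * (X 0).2 ^ 2 +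
        p.potentialEnergy deltaK13 (X 0).1 := rfl
    rw [hE]
    norm_num at hVcr hPE2 hkin ⊢
    linarith
  exact p.poleSlip_of_excessEnergy hM hD hPmax heq deltaK13_pos.le deltaK13_lt_pi_div_two hXlit
    hδc hδcu hωc (by norm_num : (0 : ℝ) < 1 / 1000) hexcess

end Summit.Ventures.GridStability.Models.SMIB

end
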